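import Summits.CriticalPhenomena.PercolationContinuityZ3.Theorems.PercAnnulusCrossingIICRootBypass
import HarnessLib

/-!
# The k-point function of Kesten's IIC is at most `C^k ∏ π(edge lengths)` along every nearest-parent insertion — no separation (lane RSW3, p1 gen 22)

builds on p205010 (kernel theorem, internal audit signed; external expert review pending) — USED through `θ(p_c) = 0` (exact re-rooting
and the IIC at a shifted root, inside `…IICRootBypass`).

RSW3 lane (LANE 3 `prim-rsw3`), seat `prim-rsw3-p1` (gen 22).  Helper file (`--supports stmt-CriticalPhenomena-4575`); no definitions,
no sorries.  Memo `run/shared/lean/prim/rsw3/P1-QM.md` §35.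

Gen 21 (`…IICManyPointsTreeUpper`) proved `ν(z_1, …, z_k ∈ C(0)) ≤ C^k ∏_i π(‖z_i − z_{p(i)}‖)` for sites inserted along a `4ls`-SEPARATED
dendrogram, under (A2)□ + `CU⁺_l` + UAD.  The root-bypass inequality of `…IICRootBypass` replaces the separation around the ROOT by the
natural condition around the NEW SITE — its parent is a NEAREST point among the sites already present — and drops UAD:

* **`exists_iicMeasure_real_openConn_inter_biInter_le_mul_nearest_criticalProbI`** — `p_c(ℤ^d)`, `d ≥ 2`, (A2)□(s,L) + `CU⁺_l`: `∃ n₀ C`,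
  **`ν({0 ↔ v} ∩ ⋂_{z∈S}{0 ↔ z}) ≤ C·π_{p_c}(‖v‖)·ν(⋂_{z∈S}{0 ↔ z})` whenever `‖v‖ ≥ n₀` and `‖z − v‖ ≥ ‖v‖` on `S`** (the root is a nearest
  point of `{0} ∪ S` to `v`);
* **`exists_iicMeasure_real_biInter_openConn_le_pow_mul_prod_nearest_criticalProbI`** — there are `n₀ ≥ 1`, `C > 0` such that for every IIC
  probability measure `ν`, every `k`, all sites `z_0 = 0, z_1, …, z_k` and parents `p(i) < i` with `‖z_i − z_{p(i)}‖ ≥ n₀` and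
  **`‖z_i − z_{p(i)}‖ ≤ ‖z_i − z_j‖` for all `j < i`** (each site is attached to a nearest earlier site — Prim's algorithm produces such an
  order for every finite configuration, and then the `‖z_i − z_{p(i)}‖` are the edge lengths of a minimal spanning tree):
  **`ν(⋂_{i=1}^{k}{0 ↔ z_i}) ≤ C^k · ∏_{i=1}^{k} π_{p_c}(‖z_i − z_{p(i)}‖_∞)`**.  With `…IICSpanningTreeLower`:
  **`c^k ∏_{e ∈ MST} π_{p_c}(|e|) ≤ ν(S ⊆ C(0)) ≤ C^k ∏_{e ∈ MST} π_{p_c}(|e|)` for EVERY finite configuration `S` with MST edges `≥ n₀`** —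
  THE k-POINT FUNCTION OF KESTEN'S IIC IS THE MINIMAL SPANNING TREE, with no separation hypothesis (two-sided form: `…IICSpanningTree`).
References: H. Kesten, PTRF 73 (1986) Thm. (3), (8); D. Basu, A. Sapozhnikov, ECP 22 (2017) Thm. 1.1, Remark 2.1; R. C. Prim, Bell Syst.
Tech. J. 36 (1957).
-/

noncomputable section

namespace Summit.CriticalPhenomena.PercolationContinuityZ3.Theorems.Crossing

open MeasureTheory Filter Topology Literature.Probability.Percolation Literature.Probability.LatticeModels
open Literature.Probability.Percolation.DCT16
open Summit.CriticalPhenomena.PercolationContinuityZ3.Theorems.SurfaceTension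

variable {d : ℕ}

/-! ## §1 At `p_c(ℤ^d)`: a new site costs at most one arm to its nearest point -/

/-- **A NEW SITE JOINS KESTEN'S IIC AT MOST AT THE ONE-ARM PRICE TO ITS NEAREST POINT** (`p_c(ℤ^d)`, `d ≥ 2`; (A2)□ at aspect `(s,L)`,
`2 ≤ s ≤ L`, `ϰ > 0`; `CU⁺_l(c_U)`, `l ≥ 2`, `c_U > 0`; `θ(p_c) = 0` via p205010; NO annulus decay, NO separation): there are `n₀ ≥ 1` and
`C > 0` such that for every IIC probability measure `ν`, every site `v` with `‖v‖ ≥ n₀` and every finite `S` with `‖z − v‖ ≥ ‖v‖` for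
`z ∈ S` (the root is a nearest point of `{0} ∪ S` to `v`): **`ν({0 ↔ v} ∩ ⋂_{z∈S}{0 ↔ z}) ≤ C·π_{p_c}(‖v‖)·ν(⋂_{z∈S}{0 ↔ z})`**
(`n₀ = 4l`, `C = B^l/c_U`, `a = ⌊‖v‖/l⌋`, the ratio bound `π(a−1) ≤ B^l π(‖v‖)`).  By exact re-rooting the same holds with the root
replaced by any nearest point of `{0} ∪ S` — the step of the spanning-tree upper bound. [cite: Kesten1986, Thm. (8)]
[cite: BasuSapozhnikov2017ECP, Thm. 1.1 and Remark 2.1] -/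
theorem exists_iicMeasure_real_openConn_inter_biInter_le_mul_nearest_criticalProbI (hd : 2 ≤ d) {s L : ℕ} (hs : 2 ≤ s)
    (hsL : s ≤ L) {ϰ : ℝ} (hϰ : 0 < ϰ) (hA2 : SetToSetQuasiMultAspectAt d (criticalProbI d) s L ϰ) {l : ℕ} (hl : 2 ≤ l)
    {cU : ℝ} (hcU : 0 < cU)
    (hCU : ∀ a : ℕ, 1 ≤ a → ∀ E : Set (BondConfig (Site d)), IsUpperSet E → MeasurableSet E →
      cU * (bondPercolation (zdGraph d) (criticalProbI d)).real E ≤ (bondPercolation (zdGraph d) (criticalProbI d)).real (E ∩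
        {ω : BondConfig (Site d) | ∀ t ∈ innerBoundary (zdGraph d) (box d a), ∀ s ∈ innerBoundary (zdGraph d) (box d (l * a)),
        ∀ t' ∈ innerBoundary (zdGraph d) (box d a), ∀ s' ∈ innerBoundary (zdGraph d) (box d (l * a)),
        ω ∈ openConnIn (↑((box d (l * a) \ box d a) ∪ innerBoundary (zdGraph d) (box d a)) : Set (Site d)) t s →
        ω ∈ openConnIn (↑((box d (l * a) \ box d a) ∪ innerBoundary (zdGraph d) (box d a)) : Set (Site d)) t' s' →
        ω ∈ openConnIn (↑((box d (l * a) \ box d a) ∪ innerBoundary (zdGraph d) (box d a)) : Set (Site d)) s s'})) :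
    ∃ (n₀ : ℕ) (C : ℝ), 1 ≤ n₀ ∧ 0 < C ∧ ∀ (ν : Measure (BondConfig (Site d))) [IsProbabilityMeasure ν],
      (∀ (F : Finset (Sym2 (Site d))) (E : Set (BondConfig (Site d))), MeasurableSet E → DeterminedBy E ↑F →
        Tendsto (fun n : ℕ => (bondPercolation (zdGraph d) (criticalProbI d)).real (E ∩ siteToBoundary d n) /
          oneArmProb d (criticalProbI d) n) atTop (𝓝 (ν.real E))) →
      ∀ (v : Site d) (S : Finset (Site d)), n₀ ≤ Site.supNorm v → (∀ z ∈ S, Site.supNorm v ≤ Site.supNorm (z - v)) →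
        ν.real ((openConn (0 : Site d) v : Set (BondConfig (Site d))) ∩
            ⋂ z ∈ S, (openConn (0 : Site d) z : Set (BondConfig (Site d)))) ≤
          C * oneArmProb d (criticalProbI d) (Site.supNorm v) *
            ν.real (⋂ z ∈ S, (openConn (0 : Site d) z : Set (BondConfig (Site d)))) := by
  have hd1 : 1 ≤ d := le_trans (by norm_num) hd
  have hp : 0 < ((criticalProbI d : unitInterval) : ℝ) := by
    rw [coe_criticalProbI]; exact criticalProb_zd_pos d hd1
  have hπ : ∀ m : ℕ, 0 < oneArmProb d (criticalProbI d) m := fun m => oneArmProb_pos hd1 _ hp m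
  have hθ : theta (zdGraph d) 0 (criticalProbI d) = 0 := CSH.percolationContinuity_allDimensions d hd
  obtain ⟨B, hB, hR⟩ := Rsw3.exists_oneArmProb_ratio_of_setToSetQuasiMultAspectAt hd hs hsL hϰ hA2
  have hRk := oneArmProb_ratio_iter (criticalProbI d) hR hπ l
  have h2l : 2 * l ≤ 8 ^ l := by
    have h8 : ∀ m : ℕ, 2 * (m + 1) ≤ 8 ^ (m + 1) := by
      intro m; induction m with
      | zero => norm_num
      | succ k ih => have : 1 ≤ 8 ^ (k + 1) := Nat.one_le_pow _ _ (by norm_num); rw [pow_succ]; omega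
    obtain ⟨m, rfl⟩ : ∃ m, l = m + 1 := ⟨l - 1, by omega⟩
    exact h8 m
  refine ⟨4 * l, B ^ l / cU, by omega, by positivity, fun ν _ hν v S hv hS => ?_⟩
  set r := Site.supNorm v with hr
  set a := r / l with ha
  have hl0 : 0 < l := by omega
  have hdm := Nat.div_add_mod r l
  have hml := Nat.mod_lt r hl0
  have ha4 : 4 ≤ a := (Nat.le_div_iff_mul_le hl0).2 (by rw [hr] at hv ⊢; linarith)
  have hla : l * a ≤ r := by rw [ha, mul_comm]; exact Nat.div_mul_le_self r l
  have hrla : r < l * a + l := by rw [ha]; omega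
  have haa : a ≤ l * a := Nat.le_mul_of_pos_left a hl0
  have h4l : l * 4 ≤ l * a := Nat.mul_le_mul_left l ha4
  -- the hypotheses of §4
  have hv' : v ∉ box d (l * a - 1) := fun h => by
    have := mem_box_iff_supNorm_le.1 h; omega
  have hS' : ∀ z ∈ S, z - v ∉ box d (l * a - 1) := fun z hz h => by
    have h1 := mem_box_iff_supNorm_le.1 h
    have h2 := hS z hz
    omega
  have hmain := iicMeasure_real_openConn_inter_biInter_le_mul hd1 _ hp hθ hs hϰ hA2 hl hcU.le hCU hν (by omega : 2 ≤ a) v S hv' hS'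
  -- the ratio `π(a−1) ≤ B^l π(r)`
  have hratio : oneArmProb d (criticalProbI d) (a - 1) ≤ B ^ l * oneArmProb d (criticalProbI d) r := by
    refine hRk (a - 1) r (by omega) (by omega) ?_
    have h1 : r ≤ 2 * l * (a - 1) := by
      have e1 : 2 * l * (a - 1) = 2 * l * a - 2 * l := by rw [Nat.mul_sub, mul_one]
      have e2 : 2 * l * a = 2 * (l * a) := by ring
      rw [e1, e2]; omega
    exact h1.trans (Nat.mul_le_mul_right _ h2l)
  have hν0 : 0 ≤ ν.real (⋂ z ∈ S, (openConn (0 : Site d) z : Set (BondConfig (Site d)))) := measureReal_nonneg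
  rw [div_mul_eq_mul_div, div_mul_eq_mul_div, le_div_iff₀ hcU]
  calc ν.real ((openConn (0 : Site d) v : Set (BondConfig (Site d))) ∩ ⋂ z ∈ S, (openConn (0 : Site d) z : Set (BondConfig (Site d)))) * cU
      = cU * ν.real ((openConn (0 : Site d) v : Set (BondConfig (Site d))) ∩ ⋂ z ∈ S, (openConn (0 : Site d) z : Set (BondConfig (Site d)))) :=
        mul_comm _ _
    _ ≤ oneArmProb d (criticalProbI d) (a - 1) * ν.real (⋂ z ∈ S, (openConn (0 : Site d) z : Set (BondConfig (Site d)))) := hmain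
    _ ≤ B ^ l * oneArmProb d (criticalProbI d) r * ν.real (⋂ z ∈ S, (openConn (0 : Site d) z : Set (BondConfig (Site d)))) :=
        mul_le_mul_of_nonneg_right hratio hν0

/-! ## §2 The spanning-tree upper bound along nearest-parent insertions -/

open Classical in
/-- **THE k-POINT FUNCTION OF KESTEN'S IIC IS AT MOST `C^k ∏ π(edge lengths)` ALONG EVERY NEAREST-PARENT INSERTION** (`p_c(ℤ^d)`, `d ≥ 2`;
(A2)□ at aspect `(s,L)`, `2 ≤ s ≤ L`, `ϰ > 0`; `CU⁺_l(c_U)`, `l ≥ 2`, `c_U > 0`; `θ(p_c) = 0` via p205010; NO annulus decay, NO separation):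
there are `n₀ ≥ 1` and `C > 0` such that for every IIC probability measure `ν`, every `k`, all sites `z_0 = 0, z_1, …, z_k` and parents
`p(i) < i` (`1 ≤ i ≤ k`) with `‖z_i − z_{p(i)}‖_∞ ≥ n₀` and `‖z_i − z_{p(i)}‖_∞ ≤ ‖z_i − z_j‖_∞` for every `j < i` (the parent is a nearest
earlier site, the root `z_0 = 0` included): **`ν(⋂_{i=1}^{k}{0 ↔ z_i}) ≤ C^k · ∏_{i=1}^{k} π_{p_c}(‖z_i − z_{p(i)}‖_∞)`**.  For the order
produced by Prim's algorithm the right-hand side is `C^k ∏_{e ∈ MST({0,z_1,…,z_k})} π_{p_c}(|e|)`. [cite: Kesten1986, Thm. (8)]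
[cite: BasuSapozhnikov2017ECP, Thm. 1.1 and Remark 2.1] -/
theorem exists_iicMeasure_real_biInter_openConn_le_pow_mul_prod_nearest_criticalProbI (hd : 2 ≤ d) {s L : ℕ} (hs : 2 ≤ s)
    (hsL : s ≤ L) {ϰ : ℝ} (hϰ : 0 < ϰ) (hA2 : SetToSetQuasiMultAspectAt d (criticalProbI d) s L ϰ) {l : ℕ} (hl : 2 ≤ l)
    {cU : ℝ} (hcU : 0 < cU)
    (hCU : ∀ a : ℕ, 1 ≤ a → ∀ E : Set (BondConfig (Site d)), IsUpperSet E → MeasurableSet E →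
      cU * (bondPercolation (zdGraph d) (criticalProbI d)).real E ≤ (bondPercolation (zdGraph d) (criticalProbI d)).real (E ∩
        {ω : BondConfig (Site d) | ∀ t ∈ innerBoundary (zdGraph d) (box d a), ∀ s ∈ innerBoundary (zdGraph d) (box d (l * a)),
          ∀ t' ∈ innerBoundary (zdGraph d) (box d a), ∀ s' ∈ innerBoundary (zdGraph d) (box d (l * a)),
          ω ∈ openConnIn (↑((box d (l * a) \ box d a) ∪ innerBoundary (zdGraph d) (box d a)) : Set (Site d)) t s →
          ω ∈ openConnIn (↑((box d (l * a) \ box d a) ∪ innerBoundary (zdGraph d) (box d a)) : Set (Site d)) t' s' →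
          ω ∈ openConnIn (↑((box d (l * a) \ box d a) ∪ innerBoundary (zdGraph d) (box d a)) : Set (Site d)) s s'})) :
    ∃ (n₀ : ℕ) (C : ℝ), 1 ≤ n₀ ∧ 0 < C ∧ ∀ (ν : Measure (BondConfig (Site d))) [IsProbabilityMeasure ν],
      (∀ (F : Finset (Sym2 (Site d))) (E : Set (BondConfig (Site d))), MeasurableSet E → DeterminedBy E ↑F →
        Tendsto (fun n : ℕ => (bondPercolation (zdGraph d) (criticalProbI d)).real (E ∩ siteToBoundary d n) /
          oneArmProb d (criticalProbI d) n) atTop (𝓝 (ν.real E))) →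
      ∀ (k : ℕ) (z : ℕ → Site d) (par : ℕ → ℕ), z 0 = 0 → (∀ i, 1 ≤ i → i ≤ k → par i < i) →
        (∀ i, 1 ≤ i → i ≤ k → n₀ ≤ Site.supNorm (z i - z (par i))) →
        (∀ i, 1 ≤ i → i ≤ k → ∀ j, j < i → Site.supNorm (z i - z (par i)) ≤ Site.supNorm (z i - z j)) →
          ν.real (⋂ i ∈ Finset.Icc 1 k, (openConn (0 : Site d) (z i) : Set (BondConfig (Site d)))) ≤
            C ^ k * ∏ i ∈ Finset.Icc 1 k, oneArmProb d (criticalProbI d) (Site.supNorm (z i - z (par i))) := by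
  have hd1 : 1 ≤ d := le_trans (by norm_num) hd
  have hp : 0 < ((criticalProbI d : unitInterval) : ℝ) := by
    rw [coe_criticalProbI]; exact criticalProb_zd_pos d hd1
  have hπ : ∀ m : ℕ, 0 < oneArmProb d (criticalProbI d) m := fun m => oneArmProb_pos hd1 _ hp m
  have hθ : theta (zdGraph d) 0 (criticalProbI d) = 0 := CSH.percolationContinuity_allDimensions d hd
  obtain ⟨n₀, C, hn₀, hC, h9⟩ :=
    exists_iicMeasure_real_openConn_inter_biInter_le_mul_nearest_criticalProbI hd hs hsL hϰ hA2 hl hcU hCU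
  refine ⟨n₀, C, hn₀, hC, fun ν _ hν k => ?_⟩
  -- re-rooting an indexed configuration
  have hreroot : ∀ (v : Site d) (T : Finset ℕ) (w : ℕ → Site d),
      ν.real ((openConn (0 : Site d) v : Set (BondConfig (Site d))) ∩ ⋂ i ∈ T, (openConn (0 : Site d) (w i) : Set (BondConfig (Site d)))) =
        ν.real ((openConn (0 : Site d) (-v) : Set (BondConfig (Site d))) ∩
          ⋂ i ∈ T, (openConn (0 : Site d) (w i - v) : Set (BondConfig (Site d)))) := by
    intro v T w
    have hE : MeasurableSet (⋂ i ∈ T, (openConn (0 : Site d) (w i) : Set (BondConfig (Site d)))) :=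
      Finset.measurableSet_biInter T fun i _ => measurableSet_openConn_holds 0 (w i)
    have h := iicMeasure_real_inter_openConn_eq_real_preimage_shift hd1 _ hp hθ hs hϰ hA2 hν v hE
    rw [Set.inter_comm, h, Set.preimage_iInter₂]
    simp_rw [preimage_relabel_shift_openConn_zero_left]
    rw [Set.inter_comm]
    congr 1
    ext ω
    simp only [Set.mem_inter_iff, Set.mem_iInter₂]
    constructor
    · rintro ⟨h0v, hall⟩
      exact ⟨h0v, fun i hi => SimpleGraph.Reachable.trans h0v (hall i hi)⟩
    · rintro ⟨h0v, hall⟩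
      exact ⟨h0v, fun i hi => SimpleGraph.Reachable.trans h0v.symm (hall i hi)⟩
  induction k with
  | zero =>
    intro z par _ _ _ _
    have h0 : Finset.Icc 1 0 = ∅ := by rfl
    have hempty : (⋂ i ∈ (∅ : Finset ℕ), (openConn (0 : Site d) (z i) : Set (BondConfig (Site d)))) = Set.univ := by
      ext ω; simp
    rw [h0, Finset.prod_empty, hempty, probReal_univ, pow_zero, one_mul]
  | succ k ih =>
    intro z par hz0 hpar hfar0 hnear
    -- the configuration up to `k`
    have ihk := ih z par hz0 (fun i h1 h2 => hpar i h1 (by omega)) (fun i h1 h2 => hfar0 i h1 (by omega))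
      (fun i h1 h2 j hj => hnear i h1 (by omega) j hj)
    have hIcc : Finset.Icc 1 (k + 1) = insert (k + 1) (Finset.Icc 1 k) := by
      ext i; simp only [Finset.mem_Icc, Finset.mem_insert]; omega
    have hnot : k + 1 ∉ Finset.Icc 1 k := by simp
    rw [hIcc, Finset.prod_insert hnot, Finset.set_biInter_insert]
    -- the new edge
    have hpk : par (k + 1) < k + 1 := hpar (k + 1) (by omega) le_rfl
    have hr : n₀ ≤ Site.supNorm (z (k + 1) - z (par (k + 1))) := hfar0 (k + 1) (by omega) le_rfl
    have hCk : 0 ≤ C ^ k := pow_nonneg hC.le k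
    have hπr := hπ (Site.supNorm (z (k + 1) - z (par (k + 1))))
    by_cases hp0 : par (k + 1) = 0
    · -- the parent is the root: attach `z (k+1)` directly
      have hr0 : Site.supNorm (z (k + 1) - z (par (k + 1))) = Site.supNorm (z (k + 1)) := by rw [hp0, hz0, sub_zero]
      have hS : ∀ w ∈ (Finset.Icc 1 k).image z, Site.supNorm (z (k + 1)) ≤ Site.supNorm (w - z (k + 1)) := by
        intro w hw
        obtain ⟨j, hj, rfl⟩ := Finset.mem_image.1 hw
        rw [Finset.mem_Icc] at hj
        have h := hnear (k + 1) (by omega) le_rfl j (by omega)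
        rwa [hr0, Site.supNorm_sub_comm (z (k + 1)) (z j)] at h
      have h := h9 ν hν (z (k + 1)) ((Finset.Icc 1 k).image z) (by rwa [hr0] at hr) hS
      rw [Finset.set_biInter_finset_image] at h
      rw [hr0]
      calc ν.real ((openConn (0 : Site d) (z (k + 1)) : Set (BondConfig (Site d))) ∩
            ⋂ i ∈ Finset.Icc 1 k, (openConn (0 : Site d) (z i) : Set (BondConfig (Site d))))
          ≤ C * oneArmProb d (criticalProbI d) (Site.supNorm (z (k + 1))) *
            ν.real (⋂ i ∈ Finset.Icc 1 k, (openConn (0 : Site d) (z i) : Set (BondConfig (Site d)))) := h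
        _ ≤ C * oneArmProb d (criticalProbI d) (Site.supNorm (z (k + 1))) *
            (C ^ k * ∏ i ∈ Finset.Icc 1 k, oneArmProb d (criticalProbI d) (Site.supNorm (z i - z (par i)))) :=
          mul_le_mul_of_nonneg_left ihk (mul_nonneg hC.le (hπ _).le)
        _ = C ^ (k + 1) * (oneArmProb d (criticalProbI d) (Site.supNorm (z (k + 1))) *
            ∏ i ∈ Finset.Icc 1 k, oneArmProb d (criticalProbI d) (Site.supNorm (z i - z (par i)))) := by ring
    · -- the parent is a site `v = z p`, `1 ≤ p ≤ k`: re-root at `v`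
      have hpmem : par (k + 1) ∈ Finset.Icc 1 k := by rw [Finset.mem_Icc]; omega
      -- `V_k = {0 ↔ v} ∩ W`
      have hVk : (⋂ i ∈ Finset.Icc 1 k, (openConn (0 : Site d) (z i) : Set (BondConfig (Site d)))) =
          (openConn (0 : Site d) (z (par (k + 1))) : Set (BondConfig (Site d))) ∩
            ⋂ i ∈ (Finset.Icc 1 k).erase (par (k + 1)), (openConn (0 : Site d) (z i) : Set (BondConfig (Site d))) := by
        rw [← Finset.insert_erase hpmem, Finset.set_biInter_insert, Finset.insert_erase hpmem]
      -- the target event as `{0 ↔ v} ∩ ⋂_{i ∈ T} {0 ↔ z i}`, `T = insert (k+1) (erase p)`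
      have hT : (openConn (0 : Site d) (z (k + 1)) : Set (BondConfig (Site d))) ∩
          ⋂ i ∈ Finset.Icc 1 k, (openConn (0 : Site d) (z i) : Set (BondConfig (Site d))) =
          (openConn (0 : Site d) (z (par (k + 1))) : Set (BondConfig (Site d))) ∩
            ⋂ i ∈ insert (k + 1) ((Finset.Icc 1 k).erase (par (k + 1))), (openConn (0 : Site d) (z i) : Set (BondConfig (Site d))) := by
        rw [hVk, Finset.set_biInter_insert, Set.inter_left_comm]
      rw [hT, hreroot (z (par (k + 1))) (insert (k + 1) ((Finset.Icc 1 k).erase (par (k + 1)))) z]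
      -- after re-rooting: `{0 ↔ z(k+1) − v} ∩ ({0 ↔ −v} ∩ ⋂_{erase} {0 ↔ z i − v})`
      rw [Finset.set_biInter_insert, Set.inter_left_comm]
      -- the configuration seen from `v`: every site is at least as far from the new site as `v`
      have hS : ∀ w ∈ insert (-z (par (k + 1))) (((Finset.Icc 1 k).erase (par (k + 1))).image fun i => z i - z (par (k + 1))),
          Site.supNorm (z (k + 1) - z (par (k + 1))) ≤ Site.supNorm (w - (z (k + 1) - z (par (k + 1)))) := by
        intro w hw
        rcases Finset.mem_insert.1 hw with rfl | hw
        · have h := hnear (k + 1) (by omega) le_rfl 0 (by omega)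
          have e : -z (par (k + 1)) - (z (k + 1) - z (par (k + 1))) = -(z (k + 1) - z 0) := by rw [hz0]; abel
          rwa [e, Site.supNorm_neg]
        · obtain ⟨j, hj, rfl⟩ := Finset.mem_image.1 hw
          rw [Finset.mem_erase, Finset.mem_Icc] at hj
          have h := hnear (k + 1) (by omega) le_rfl j (by omega)
          have e : z j - z (par (k + 1)) - (z (k + 1) - z (par (k + 1))) = -(z (k + 1) - z j) := by abel
          rwa [e, Site.supNorm_neg]
      have h := h9 ν hν (z (k + 1) - z (par (k + 1)))
        (insert (-z (par (k + 1))) (((Finset.Icc 1 k).erase (par (k + 1))).image fun i => z i - z (par (k + 1)))) hr hS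
      rw [Finset.set_biInter_insert, Finset.set_biInter_finset_image] at h
      -- re-root back: `ν({0 ↔ −v} ∩ ⋂_{erase} {0 ↔ z i − v}) = ν({0 ↔ v} ∩ ⋂_{erase} {0 ↔ z i}) = ν(V_k)`
      have hback : ν.real ((openConn (0 : Site d) (-z (par (k + 1))) : Set (BondConfig (Site d))) ∩
          ⋂ i ∈ (Finset.Icc 1 k).erase (par (k + 1)), (openConn (0 : Site d) (z i - z (par (k + 1))) : Set (BondConfig (Site d)))) =
          ν.real (⋂ i ∈ Finset.Icc 1 k, (openConn (0 : Site d) (z i) : Set (BondConfig (Site d)))) := by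
        rw [hVk]; exact (hreroot (z (par (k + 1))) ((Finset.Icc 1 k).erase (par (k + 1))) z).symm
      rw [hback] at h
      refine h.trans ?_
      calc C * oneArmProb d (criticalProbI d) (Site.supNorm (z (k + 1) - z (par (k + 1)))) *
            ν.real (⋂ i ∈ Finset.Icc 1 k, (openConn (0 : Site d) (z i) : Set (BondConfig (Site d))))
          ≤ C * oneArmProb d (criticalProbI d) (Site.supNorm (z (k + 1) - z (par (k + 1)))) *
            (C ^ k * ∏ i ∈ Finset.Icc 1 k, oneArmProb d (criticalProbI d) (Site.supNorm (z i - z (par i)))) :=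
          mul_le_mul_of_nonneg_left ihk (mul_nonneg hC.le hπr.le)
        _ = C ^ (k + 1) * (oneArmProb d (criticalProbI d) (Site.supNorm (z (k + 1) - z (par (k + 1)))) *
            ∏ i ∈ Finset.Icc 1 k, oneArmProb d (criticalProbI d) (Site.supNorm (z i - z (par i)))) := by ring

end Summit.CriticalPhenomena.PercolationContinuityZ3.Theorems.Crossing

end
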